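import Mathlib
import Summits.ValiantsHypothesis.ValiantsHypothesis.Theorems.GrenetZeonTwoDimCoefficientsScalingRankFactorization
import Summits.ValiantsHypothesis.ValiantsHypothesis.Theorems.GrenetZeonTwoDimCoefficientsScalingSpecializationDescent
import Summits.ValiantsHypothesis.ValiantsHypothesis.Theorems.GrenetZeonTwoDimCoefficientsScalingSeparableCert

/-!
# Crux `GrenetZeon.TwoDimCoefficients` (stmt-ValiantsHypothesis-8062), stub `stub_dualUnipotent`:
# scaling-closure — a GENERIC NUMERATOR DIRECTION separates the ray roots (lemmas F3b/F3c of EIGHTEENTH-HAND.md)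

Pointwise heart of the numerator-perturbation argument (memo EIGHTEENTH-HAND.md §NEW).  At the chosen point `z₀` the
ray polynomial of the pair `(A, θ·B + C)` is `c·det(1_m + u·N₀(θ·M₀ + K))` with `N₀ = N(z₀)^{n−1}` of rank `r`,
`M₀` from `B` and `K` from `C` (ours to choose).  We choose `K` through a rank factorisation `N₀ = U·V`
(✓ `exists_rank_factorization`) so that the compression `V·K·U` is `diag(1, 2, …, r)`:

* `charpolyRev_neg_diagonal`, `squarefree_rayPoly_diagonal`, `natDegree_rayPoly_diagonal` — at `θ = 0` the compressed
  ray polynomial is `c·Π_{i<r}(1 + (i+1)·u)`: squarefree of full degree `r`.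
* ★ `exists_numerator_direction` — for all complex `N₀, M₀` and `c ≠ 0` there is `K` such that for INFINITELY MANY
  `θ` the polynomial `R_θ(u) = c·det(1_m + u·N₀(θ·M₀ + K))` has `r = rank N₀` distinct non-zero simple roots and
  `[u^r]R_θ ≠ 0` (squarefree descent by specialisation ✓ `squarefree_map_fractionRing_of_specialization` over `ℂ[θ]`,
  Bézout certificate ✓ `exists_certificate_of_separable_map`, cofinitely many good `θ`, roots in `ℂ`).

HONEST FRAMING: generic linear algebra over `ℂ`; the stub `DualUnipotentBound`, both cruxes (stmt-8062, stmt-24318)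
and `VP ≠ VNP` remain open.

References: folklore.
-/

-- single-conjunct layout `Summits/ValiantsHypothesis/ValiantsHypothesis`: the duplicated namespace
-- component is mandated by the tree.
set_option linter.dupNamespace false
set_option autoImplicit false

noncomputable section

namespace Summit.ValiantsHypothesis.ValiantsHypothesis.Theorems.GrenetZeonTwoDimCoefficients.ScalingClosure

open Matrix Polynomial

section Diagonal

variable {R : Type*} [CommRing R] {r : ℕ}

/-- `det(1 + u·diag(d)) = Π (1 + d_i u)`. [folklore] -/
theorem charpolyRev_neg_diagonal (d : Fin r → R) :
    (-(Matrix.diagonal d)).charpolyRev = ∏ i, (1 + Polynomial.C (d i) * Polynomial.X) := by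
  rw [Matrix.charpolyRev]
  have h : (1 : Matrix (Fin r) (Fin r) R[X]) - (X : R[X]) • (-(Matrix.diagonal d)).map C =
      Matrix.diagonal (fun i => 1 + C (d i) * X) := by
    apply Matrix.ext; intro i j
    simp only [Matrix.sub_apply, Matrix.smul_apply, Matrix.map_apply, Matrix.neg_apply, Matrix.diagonal_apply,
      Matrix.one_apply, smul_eq_mul]
    split_ifs <;> simp
  rw [h, Matrix.det_diagonal]

/-- The model ray polynomial `Π_{i<r} (1 + (i+1)·u)` over `ℂ`: squarefree. [folklore] -/
theorem squarefree_rayPoly_diagonal :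
    Squarefree (∏ i : Fin r, (1 + Polynomial.C (((i : ℕ) : ℂ) + 1) * Polynomial.X)) := by
  have hne : ∀ i : Fin r, (((i : ℕ) : ℂ) + 1) ≠ 0 := fun i => by
    exact_mod_cast Nat.succ_ne_zero i
  have hfac : (∏ i : Fin r, (1 + Polynomial.C (((i : ℕ) : ℂ) + 1) * Polynomial.X)) =
      Polynomial.C (∏ i : Fin r, (((i : ℕ) : ℂ) + 1)) * ∏ i : Fin r, (X - Polynomial.C (-(((i : ℕ) : ℂ) + 1)⁻¹)) := by
    rw [map_prod, ← Finset.prod_mul_distrib]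
    refine Finset.prod_congr rfl fun i _ => ?_
    rw [map_neg, sub_neg_eq_add, mul_add, ← Polynomial.C_mul, mul_inv_cancel₀ (hne i), Polynomial.C_1, add_comm]
  have hinj : Function.Injective (fun i : Fin r => -(((i : ℕ) : ℂ) + 1)⁻¹) := by
    intro i j h
    have h' : (((i : ℕ) : ℂ) + 1) = (((j : ℕ) : ℂ) + 1) := by
      have := neg_injective h
      exact inv_injective this
    exact Fin.ext (by exact_mod_cast (add_right_cancel h'))
  have hsep : (∏ i : Fin r, (X - Polynomial.C (-(((i : ℕ) : ℂ) + 1)⁻¹))).Separable :=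
    (Polynomial.separable_prod_X_sub_C_iff' ).mpr fun x _ y _ h => hinj h
  rw [hfac]
  have hu : IsUnit (Polynomial.C (∏ i : Fin r, (((i : ℕ) : ℂ) + 1))) :=
    Polynomial.isUnit_C.mpr (IsUnit.mk0 _ (Finset.prod_ne_zero_iff.mpr fun i _ => hne i))
  exact hsep.squarefree.squarefree_of_dvd ((hu.mul_left_dvd).mpr dvd_rfl)

/-- … and of full degree `r`. [folklore] -/
theorem natDegree_rayPoly_diagonal :
    (∏ i : Fin r, (1 + Polynomial.C (((i : ℕ) : ℂ) + 1) * Polynomial.X)).natDegree = r := by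
  have hne : ∀ i : Fin r, (((i : ℕ) : ℂ) + 1) ≠ 0 := fun i => by
    exact_mod_cast Nat.succ_ne_zero i
  have hdeg : ∀ i : Fin r, (1 + Polynomial.C (((i : ℕ) : ℂ) + 1) * Polynomial.X).natDegree = 1 := by
    intro i
    rw [add_comm, Polynomial.natDegree_add_eq_left_of_natDegree_lt] <;>
      rw [Polynomial.natDegree_C_mul_X _ (hne i)]
    rw [Polynomial.natDegree_one]; exact Nat.one_pos
  rw [Polynomial.natDegree_prod _ _ (fun i _ => ?_)]
  · rw [Finset.sum_congr rfl (fun i _ => hdeg i)]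
    simp
  · intro h
    have := hdeg i
    rw [h, Polynomial.natDegree_zero] at this
    exact zero_ne_one this

end Diagonal

section Generic

variable {m : ℕ}

/-- Separable polynomials have simple roots: `p(a) = 0 ⟹ p′(a) ≠ 0`. [folklore] -/
theorem eval_derivative_ne_zero_of_separable {K : Type*} [Field K] {p : Polynomial K} (hp : p.Separable) {a : K}
    (ha : p.eval a = 0) : (Polynomial.derivative p).eval a ≠ 0 := by
  intro hd
  obtain ⟨u, v, huv⟩ := hp
  have h := congrArg (Polynomial.eval a) huv
  rw [Polynomial.eval_add, Polynomial.eval_mul, Polynomial.eval_mul, ha, hd, mul_zero, mul_zero, add_zero,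
    Polynomial.eval_one] at h
  exact zero_ne_one h

/-- Roots of a separable complex polynomial of degree `r`, enumerated injectively by `Fin r`. [folklore] -/
theorem exists_roots_enum_of_separable (p : Polynomial ℂ) (hsep : p.Separable) {r : ℕ} (hdeg : p.natDegree = r) :
    ∃ t : Fin r → ℂ, Function.Injective t ∧ ∀ i, p.eval (t i) = 0 := by
  classical
  have hp0 : p ≠ 0 := hsep.ne_zero
  have hsplit : Multiset.card p.roots = r := by
    rw [← hdeg]
    exact (IsAlgClosed.splits p).natDegree_eq_card_roots.symm
  have hnodup : p.roots.Nodup := Polynomial.nodup_roots hsep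
  have hscard : p.roots.toFinset.card = r := by rw [Multiset.toFinset_card_of_nodup hnodup, hsplit]
  refine ⟨fun i => ((p.roots.toFinset.equivFin.symm (Fin.cast hscard.symm i) : p.roots.toFinset) : ℂ), ?_, ?_⟩
  · intro i j hij
    exact (Fin.cast_injective hscard.symm) (p.roots.toFinset.equivFin.symm.injective (Subtype.ext hij))
  · intro i
    have hmem := (p.roots.toFinset.equivFin.symm (Fin.cast hscard.symm i)).2
    rw [Multiset.mem_toFinset, Polynomial.mem_roots hp0] at hmem
    exact hmem

/-- Specialising a Bézout certificate: off the zeros of `g`, the fibre is separable. [folklore] -/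
theorem separable_map_eval_of_certificate (Rt a b : Polynomial (Polynomial ℂ)) (g : Polynomial ℂ)
    (hcert : a * Rt + b * Polynomial.derivative Rt = Polynomial.C g) {θ : ℂ} (hg : g.eval θ ≠ 0) :
    (Rt.map (Polynomial.evalRingHom θ)).Separable := by
  have h := congrArg (Polynomial.map (Polynomial.evalRingHom θ)) hcert
  rw [Polynomial.map_add, Polynomial.map_mul, Polynomial.map_mul, ← Polynomial.derivative_map, Polynomial.map_C,
    Polynomial.coe_evalRingHom] at h
  refine ⟨Polynomial.C (g.eval θ)⁻¹ * a.map (Polynomial.evalRingHom θ),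
    Polynomial.C (g.eval θ)⁻¹ * b.map (Polynomial.evalRingHom θ), ?_⟩
  rw [mul_assoc, mul_assoc, ← mul_add, h, ← Polynomial.C_mul, inv_mul_cancel₀ hg, Polynomial.C_1]

/-- The complement of the zero set of a non-zero complex polynomial is infinite. [folklore] -/
theorem infinite_eval_ne_zero (q : Polynomial ℂ) (hq : q ≠ 0) : Set.Infinite {θ : ℂ | q.eval θ ≠ 0} := by
  classical
  have hfin : {θ : ℂ | q.eval θ = 0}.Finite :=
    (Multiset.finite_toSet q.roots).subset fun θ hθ => (Polynomial.mem_roots hq).mpr hθ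
  have hset : {θ : ℂ | q.eval θ ≠ 0} = {θ : ℂ | q.eval θ = 0}ᶜ := by ext θ; simp
  rw [hset]
  exact hfin.infinite_compl

/-- ★ **A generic numerator direction separates the ray roots.**  For complex `N₀, M₀` (`m × m`) and `c ≠ 0` there is
`K` such that for infinitely many `θ ∈ ℂ` the polynomial `R_θ = c·det(1 + u·N₀(θM₀ + K))` has `r = rank N₀` distinct
non-zero simple roots and `[u^r]R_θ ≠ 0`. [folklore] -/
theorem exists_numerator_direction (N₀ M₀ : Matrix (Fin m) (Fin m) ℂ) (c : ℂ) (hc : c ≠ 0) :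
    ∃ K : Matrix (Fin m) (Fin m) ℂ, Set.Infinite {θ : ℂ | ∃ t : Fin N₀.rank → ℂ, Function.Injective t ∧
      (∀ i, t i ≠ 0) ∧
      (∀ i, (Polynomial.C c * (-(N₀ * (θ • M₀ + K))).charpolyRev).eval (t i) = 0) ∧
      (∀ i, (Polynomial.derivative (Polynomial.C c * (-(N₀ * (θ • M₀ + K))).charpolyRev)).eval (t i) ≠ 0) ∧
      (Polynomial.C c * (-(N₀ * (θ • M₀ + K))).charpolyRev).coeff N₀.rank ≠ 0} := by
  classical
  obtain ⟨U, V, Q, P, hUV, hQU, hVP⟩ := exists_rank_factorization N₀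
  obtain ⟨T, hT⟩ : ∃ T : Matrix (Fin N₀.rank) (Fin N₀.rank) ℂ, T = Matrix.diagonal fun i : Fin N₀.rank => (((i : ℕ) : ℂ) + 1) :=
    ⟨_, rfl⟩
  refine ⟨P * T * Q, ?_⟩
  -- compression: `R_θ = c·charpolyRev(−(θE + T))`, `E = V M₀ U`
  obtain ⟨E, hE⟩ : ∃ E : Matrix (Fin N₀.rank) (Fin N₀.rank) ℂ, E = V * M₀ * U := ⟨_, rfl⟩
  have hVKU : V * (P * T * Q) * U = T := by
    calc V * (P * T * Q) * U = (V * P) * T * (Q * U) := by simp only [Matrix.mul_assoc]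
      _ = T := by rw [hVP, hQU, Matrix.one_mul, Matrix.mul_one]
  have hcomp : ∀ θ : ℂ, (-(N₀ * (θ • M₀ + P * T * Q))).charpolyRev = (-(θ • E + T)).charpolyRev := by
    intro θ
    have h1 : -(N₀ * (θ • M₀ + P * T * Q)) = U * (-(V * (θ • M₀ + P * T * Q))) := by
      rw [Matrix.mul_neg, ← Matrix.mul_assoc, ← hUV]
    have h2 : -(V * (θ • M₀ + P * T * Q)) * U = -(θ • E + T) := by
      rw [Matrix.neg_mul, Matrix.mul_add, Matrix.add_mul, Matrix.mul_smul, Matrix.smul_mul, hVKU, hE]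
    rw [h1, charpolyRev_mul_comm', h2]
  -- the family over `ℂ[θ]` and its specialisations
  obtain ⟨G, hG⟩ : ∃ G : Matrix (Fin N₀.rank) (Fin N₀.rank) (Polynomial ℂ),
      G = (X : ℂ[X]) • E.map Polynomial.C + T.map Polynomial.C := ⟨_, rfl⟩
  obtain ⟨Rt, hRt⟩ : ∃ Rt : Polynomial (Polynomial ℂ), Rt = Polynomial.C (Polynomial.C c) * (-G).charpolyRev :=
    ⟨_, rfl⟩
  have hGθ : ∀ θ : ℂ, (-G).map (Polynomial.evalRingHom θ) = -(θ • E + T) := by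
    intro θ
    apply Matrix.ext; intro i j
    simp only [hG, Matrix.map_apply, Matrix.neg_apply, Matrix.add_apply, Matrix.smul_apply, smul_eq_mul,
      Polynomial.coe_evalRingHom, Polynomial.eval_neg, Polynomial.eval_add, Polynomial.eval_mul, Polynomial.eval_X,
      Polynomial.eval_C]
  have hspec : ∀ θ : ℂ, Rt.map (Polynomial.evalRingHom θ) = Polynomial.C c * (-(θ • E + T)).charpolyRev := by
    intro θ
    rw [hRt, Polynomial.map_mul, Polynomial.map_C, ← charpolyRev_map, hGθ, Polynomial.coe_evalRingHom,
      Polynomial.eval_C]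
  -- at `θ = 0`: the explicit squarefree polynomial of degree `r`
  have hspec0 : Rt.map (Polynomial.evalRingHom 0) =
      Polynomial.C c * ∏ i : Fin N₀.rank, (1 + Polynomial.C (((i : ℕ) : ℂ) + 1) * Polynomial.X) := by
    rw [hspec 0, zero_smul, zero_add, hT, charpolyRev_neg_diagonal]
  have hcu : IsUnit (Polynomial.C c) := Polynomial.isUnit_C.mpr (IsUnit.mk0 _ hc)
  have hsq0 : Squarefree (Rt.map (Polynomial.evalRingHom 0)) := by
    rw [hspec0]
    exact squarefree_rayPoly_diagonal.squarefree_of_dvd ((hcu.mul_left_dvd).mpr dvd_rfl)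
  have hdeg0 : (Rt.map (Polynomial.evalRingHom 0)).natDegree = N₀.rank := by
    rw [hspec0, Polynomial.natDegree_C_mul hc, natDegree_rayPoly_diagonal]
  have hRt_le : Rt.natDegree ≤ N₀.rank := by
    rw [hRt]
    refine (Polynomial.natDegree_C_mul_le _ _).trans ?_
    have h := natDegree_charpolyRev_le (-G)
    rwa [Fintype.card_fin] at h
  have hdegeq : (Rt.map (Polynomial.evalRingHom 0)).natDegree = Rt.natDegree :=
    le_antisymm Polynomial.natDegree_map_le (by rw [hdeg0]; exact hRt_le)
  -- squarefree over `ℂ(θ)`, hence separable, hence a certificate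
  haveI hgcd : IsGCDMonoid (Polynomial ℂ) := inferInstance
  have hsqK : Squarefree (Rt.map (algebraMap (Polynomial ℂ) (FractionRing (Polynomial ℂ)))) :=
    @squarefree_map_fractionRing_of_specialization (Polynomial ℂ) _ _ hgcd (FractionRing (Polynomial ℂ)) _ _ _
      ℂ _ _ (Polynomial.evalRingHom 0) Rt hdegeq hsq0
  obtain ⟨a, b, g, hg, hcert⟩ := exists_certificate_of_separable_map Rt
    (PerfectField.separable_iff_squarefree.mpr hsqK)
  -- the leading coefficient does not vanish identically
  have hlcne : Rt.coeff N₀.rank ≠ 0 := by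
    intro h
    have h1 : (Rt.map (Polynomial.evalRingHom 0)).coeff N₀.rank = 0 := by
      rw [Polynomial.coeff_map, h, map_zero]
    have h2 := Polynomial.leadingCoeff_ne_zero.mpr hsq0.ne_zero
    rw [Polynomial.leadingCoeff, hdeg0] at h2
    exact h2 h1
  -- good parameters: off the finitely many roots of `g·lc`
  refine (infinite_eval_ne_zero (g * Rt.coeff N₀.rank) (mul_ne_zero hg hlcne)).mono fun θ hθ => ?_
  have hgθ : g.eval θ ≠ 0 := fun h => hθ (by rw [Polynomial.eval_mul, h, zero_mul])
  have hlcθ : (Rt.coeff N₀.rank).eval θ ≠ 0 := fun h => hθ (by rw [Polynomial.eval_mul, h, mul_zero])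
  -- the specialised polynomial
  have hpR : Polynomial.C c * (-(N₀ * (θ • M₀ + P * T * Q))).charpolyRev = Rt.map (Polynomial.evalRingHom θ) := by
    rw [hcomp θ, hspec θ]
  have hsep : (Rt.map (Polynomial.evalRingHom θ)).Separable := separable_map_eval_of_certificate Rt a b g hcert hgθ
  have hpdeg : (Rt.map (Polynomial.evalRingHom θ)).natDegree = N₀.rank := by
    refine le_antisymm (Polynomial.natDegree_map_le.trans hRt_le) (Polynomial.le_natDegree_of_ne_zero ?_)
    rw [Polynomial.coeff_map, Polynomial.coe_evalRingHom]
    exact hlcθ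
  obtain ⟨t, ht_inj, ht_root⟩ := exists_roots_enum_of_separable _ hsep hpdeg
  have hp00 : (Rt.map (Polynomial.evalRingHom θ)).eval 0 = c := by
    rw [← hpR, Polynomial.eval_mul, Polynomial.eval_C, Matrix.eval_charpolyRev, mul_one]
  refine ⟨t, ht_inj, fun i h0 => ?_, fun i => ?_, fun i => ?_, ?_⟩
  · have h := ht_root i
    rw [h0, hp00] at h
    exact hc h
  · rw [hpR]; exact ht_root i
  · rw [hpR]; exact eval_derivative_ne_zero_of_separable hsep (ht_root i)
  · rw [hpR, Polynomial.coeff_map, Polynomial.coe_evalRingHom]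
    exact hlcθ

end Generic

end Summit.ValiantsHypothesis.ValiantsHypothesis.Theorems.GrenetZeonTwoDimCoefficients.ScalingClosure

end
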